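import Literature.Topology.FourManifolds.CorkDecomposition
import Literature.Topology.FourManifolds.SmoothOrientationGluing
import Mathlib.Geometry.Manifold.IsManifold.InteriorBoundary
import Mathlib.LinearAlgebra.Matrix.Block
import HarnessLib

/-!
# Boundary orientations: the boundary of an oriented manifold with boundary is oriented

Topic `Literature/Topology/FourManifolds`; general differential topology written for the fact
seat `provefact-Literature.IsHandlebody.exists_diffeomorph_isOrientationReversing_boundary` (F2b₂ of
`LickorishWallaceSphereGluing.lean`, "every handlebody admits an orientation-reversing
symmetry": the symmetry of the boundary surface must reverse *some* orientation of it, so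
boundary surfaces need orientations functorial under diffeomorphisms).  `SmoothOrientation.lean`
deferred boundary orientations ("Product and boundary orientations are not provided here … the
natural constructions need collars"); this file provides them **without collars**, directly in
the restricted boundary charts of `Cobordism.lean` (`Literature.BoundaryManifold.boundaryChart p =
tail ∘ chartAt p.1 ∘ Subtype.val`).  Everything here is **proved**.

## Mathematics

Let `W` be a `C^∞` manifold with boundary modelled on `𝓡∂ (n + 1)` (half-space
`{x | 0 ≤ x 0} ⊂ ℝⁿ⁺¹`).  A chart change `τ` of `W` at a boundary point `x` maps the half-space
to itself and its boundary hyperplane `{x 0 = 0}` to itself, so its derivative `L` (within the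
half-space) satisfies `L (0, u) = (0, Lt u)` where `Lt` is the derivative of the induced chart
change of `∂W`, and `(L e₀) 0 ≥ 0` for the inward normal `e₀`; as `L` is invertible,
`(L e₀) 0 > 0` and `det L = (L e₀) 0 · det Lt` (block triangular matrix), so **`det L` and
`det Lt` have the same sign** (Hirsch, *Differential Topology* (1976), §4.4, p. 103, proof that
`∂M` is orientable when `M` is; Lee, *Introduction to Smooth Manifolds* (2013), Prop. 15.24).
Hence an orientation `o` of `W` (a locally constant sign choice relative to the chart changes,
`Literature.Topology.FourManifolds.SmoothOrientation`) induces one of `∂W` by transferring `o p.1` along the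
negation-equivariant bijection `Or(ℝⁿ⁺¹) → Or(ℝⁿ)` encoding the convention **outward normal
first** (`boundaryOrientationMap`: standard ↦ opposite of standard, since the outward normal is
`-e₀` in the half-space `{0 ≤ x 0}`; Hirsch §4.4, Lee Prop. 15.24, and the tree's convention
"standard orientation of `𝕊ⁿ` = boundary orientation of `𝔻ⁿ⁺¹`",
`SmoothOrientationSphereProofs.lean`), and the same computation applied to a boundary-preserving
map `Φ` instead of a chart change shows that the orientation character of `Φ` at a boundary
point equals that of its boundary restriction.

## Main definitions and results

* §1 `Literature.Topology.FourManifolds.det_eq_snd_mul_det_of_apply_inl` — `det [[S, *], [0, λ]] = λ · det S` on `F × ℝ`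
  (Mathlib `Matrix.det_fromBlocks_zero₂₁`).
* §2 `Literature.Topology.FourManifolds.consZeroL`, `tailL`, `e0`, `det_eq_mul_det_of_comp_consZeroL`,
  `HalfSpace.hasFDerivAt_boundaryMap`, `HalfSpace.apply_e0_zero_nonneg`, `HalfSpace.det_pos_iff`
  — the calculus at a boundary point of the half-space described above.
* §3 `Literature.Topology.FourManifolds.BoundaryManifold.hasFDerivAt_boundaryCharts` (core lemma: a boundary-preserving map
  read in boundary charts), `BoundaryManifold.det_tangentCoordChange_pos_iff` (chart changes of
  `∂W` vs `W`), `BoundaryManifold.hasMFDerivAt_boundaryMap` (the boundary restriction `ρ` of a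
  differentiable `Φ` with invertible differential is differentiable, with Jacobian of the same
  sign).
* §4 `Literature.Topology.FourManifolds.SmoothOrientation.boundary` — **the boundary orientation**; `isOrientable_boundary`;
  functoriality `IsOrientationPreserving.boundaryMap`, `IsOrientationReversing.boundaryMap`,
  `Diffeomorph.isOrientationPreserving_boundaryMap`, `Diffeomorph.isOrientationReversing_boundaryMap`
  (pointwise, no connectedness needed).
* §5 `Literature.Topology.FourManifolds.BoundaryData.orientation`, `BoundaryData.isOrientable_carrier` — the same for an
  arbitrary boundary datum (pull back along `BoundaryData.restrictDiffeomorph` of the identity,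
  `CorkDecomposition.lean`).

## References

* M. W. Hirsch, *Differential Topology*, GTM 33, Springer (1976), Ch. 4 §4, pp. 100–103
  (orientations; `∂M` orientable if `M` is). [HirschDT1976]
* J. M. Lee, *Introduction to Smooth Manifolds*, 2nd ed., GTM 218 (2013), Thm. 5.11, Cor. 5.30,
  Prop. 15.24 (induced orientation on the boundary). [LeeSmoothManifolds2013]
-/

open scoped Manifold ContDiff Topology Matrix
open Function Set Module

noncomputable section

namespace Literature.Topology.FourManifolds

universe u v

/-- Local notation: `𝔼 n` is the model Euclidean space `EuclideanSpace ℝ (Fin n)`. -/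
local notation "𝔼 " n:arg => EuclideanSpace ℝ (Fin n)

/-! ### §1 Linear algebra: determinant of a block-triangular endomorphism of `F × ℝ` -/

section BlockDet

variable {F : Type*} [AddCommGroup F] [Module ℝ F] [FiniteDimensional ℝ F]

/-- **Determinant of a block upper-triangular endomorphism of `F × ℝ`.** If a linear map
`T : F × ℝ → F × ℝ` preserves the hyperplane `F × {0}`, acting there as `S : F → F`
(`T (a, 0) = (S a, 0)`), then `det T = (T (0, 1)).2 · det S`: in a basis of `F` followed by
`(0, 1)` the matrix of `T` is `[[S, *], [0, λ]]` with `λ = (T (0, 1)).2`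
(Mathlib `Matrix.det_fromBlocks_zero₂₁`). [folklore] -/
theorem det_eq_snd_mul_det_of_apply_inl (T : (F × ℝ) →ₗ[ℝ] (F × ℝ)) (S : F →ₗ[ℝ] F)
    (h : ∀ a, T (a, 0) = (S a, 0)) : LinearMap.det T = (T (0, 1)).2 * LinearMap.det S := by
  classical
  let bF := Module.finBasis ℝ F
  let b1 : Basis Unit ℝ ℝ := Basis.singleton Unit ℝ
  let bP : Basis (Fin (finrank ℝ F) ⊕ Unit) ℝ (F × ℝ) := bF.prod b1
  have hM : LinearMap.toMatrix bP bP T =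
      Matrix.fromBlocks (LinearMap.toMatrix bF bF S) (Matrix.of fun i _ => bF.repr (T (0, 1)).1 i)
        0 (Matrix.of fun _ _ => (T (0, 1)).2) := by
    ext i j
    rw [LinearMap.toMatrix_apply]
    rcases i with i | i <;> rcases j with j | j
    · simp [bP, Matrix.fromBlocks, Basis.prod_apply, h, LinearMap.toMatrix_apply]
    · simp [bP, b1, Matrix.fromBlocks, Basis.prod_apply]
    · simp [bP, Matrix.fromBlocks, Basis.prod_apply, h]
    · simp [bP, b1, Matrix.fromBlocks, Basis.prod_apply]
  rw [← LinearMap.det_toMatrix bP, hM, Matrix.det_fromBlocks_zero₂₁, LinearMap.det_toMatrix,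
    Matrix.det_unique, mul_comm]
  rfl

end BlockDet

/-! ### §2 Calculus at a boundary point of the half-space `{x | 0 ≤ x 0} ⊂ ℝⁿ⁺¹` -/

section HalfSpace

open BoundaryManifold

variable {n : ℕ}

/-- The boundary inclusion `u ↦ (0, u)` of `ℝⁿ` into `ℝⁿ⁺¹`, as a continuous linear map
(`BoundaryManifold.consCLE n (u, 0)`). [folklore] -/
def consZeroL (n : ℕ) : 𝔼 n →L[ℝ] 𝔼 (n + 1) :=
  (consCLE n : (𝔼 n × ℝ) →L[ℝ] 𝔼 (n + 1)).comp (ContinuousLinearMap.inl ℝ (𝔼 n) ℝ)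

/-- Dropping the first coordinate, `ℝⁿ⁺¹ → ℝⁿ`, as a continuous linear map
(`BoundaryManifold.tail`). [folklore] -/
def tailL (n : ℕ) : 𝔼 (n + 1) →L[ℝ] 𝔼 n :=
  (ContinuousLinearMap.fst ℝ (𝔼 n) ℝ).comp ((consCLE n).symm : 𝔼 (n + 1) →L[ℝ] (𝔼 n × ℝ))

/-- The inward unit normal `e₀ = (1, 0, …, 0)` of the half-space `{x | 0 ≤ x 0}`. [folklore] -/
def e0 (n : ℕ) : 𝔼 (n + 1) := consCLE n (0, 1)

/-- `consZeroL n u = (0, u)` (definitional). [folklore] -/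
@[simp] theorem consZeroL_apply (u : 𝔼 n) : consZeroL n u = consCLE n (u, 0) := rfl

/-- `tailL` is `tail` (definitional). [folklore] -/
@[simp] theorem tailL_apply (v : 𝔼 (n + 1)) : tailL n v = tail n v := rfl

/-- The first coordinate of `(0, u)` vanishes. [folklore] -/
@[simp] theorem consZeroL_apply_zero (u : 𝔼 n) : consZeroL n u 0 = 0 := rfl

/-- `tail (0, u) = u`. [folklore] -/
@[simp] theorem tail_consZeroL (u : 𝔼 n) : tail n (consZeroL n u) = u := tail_consCLE n (u, 0)

/-- The first coordinate of `e₀` is `1`. [folklore] -/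
@[simp] theorem e0_apply_zero : e0 n 0 = 1 := rfl

/-- `tail e₀ = 0`. [folklore] -/
@[simp] theorem tail_e0 : tail n (e0 n) = 0 := tail_consCLE n (0, 1)

/-- `(0, u) + t e₀ = (t, u)`. [folklore] -/
theorem consZeroL_add_smul_e0 (u : 𝔼 n) (t : ℝ) : consZeroL n u + t • e0 n = consCLE n (u, t) := by
  rw [consZeroL_apply, e0, ← map_smul, ← map_add]
  congr 1
  simp

/-- **Block determinant in `ℝⁿ⁺¹ = ∂ℍ ⊕ ℝ e₀`.** If `L : ℝⁿ⁺¹ → ℝⁿ⁺¹` preserves the boundary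
hyperplane `{x 0 = 0}`, acting there as `Lt` (`L ∘ (0, ·) = (0, Lt ·)`), then
`det L = (L e₀) 0 · det Lt`. [folklore] -/
theorem det_eq_mul_det_of_comp_consZeroL (L : 𝔼 (n + 1) →L[ℝ] 𝔼 (n + 1)) (Lt : 𝔼 n →L[ℝ] 𝔼 n)
    (h : L.comp (consZeroL n) = (consZeroL n).comp Lt) :
    LinearMap.det (L : 𝔼 (n + 1) →ₗ[ℝ] 𝔼 (n + 1)) =
      L (e0 n) 0 * LinearMap.det (Lt : 𝔼 n →ₗ[ℝ] 𝔼 n) := by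
  set e : 𝔼 (n + 1) ≃ₗ[ℝ] (𝔼 n × ℝ) := (consCLE n).symm.toLinearEquiv with he
  set T : (𝔼 n × ℝ) →ₗ[ℝ] (𝔼 n × ℝ) :=
    (e : 𝔼 (n + 1) →ₗ[ℝ] (𝔼 n × ℝ)) ∘ₗ (L : 𝔼 (n + 1) →ₗ[ℝ] 𝔼 (n + 1)) ∘ₗ
      (e.symm : (𝔼 n × ℝ) →ₗ[ℝ] 𝔼 (n + 1)) with hT
  have hconj : LinearMap.det T = LinearMap.det (L : 𝔼 (n + 1) →ₗ[ℝ] 𝔼 (n + 1)) :=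
    LinearMap.det_conj _ e
  rw [← hconj]
  have happ : ∀ p, T p = (consCLE n).symm (L (consCLE n p)) := fun p => rfl
  have h1 : ∀ a, T (a, 0) = (Lt a, 0) := by
    intro a
    rw [happ]
    have := congrArg (fun f : 𝔼 n →L[ℝ] 𝔼 (n + 1) => f a) h
    simp only [ContinuousLinearMap.comp_apply, consZeroL_apply] at this
    rw [this, ContinuousLinearEquiv.symm_apply_apply]
  rw [det_eq_snd_mul_det_of_apply_inl _ _ h1, happ]
  rfl

/-- Membership in the half-space `range (𝓡∂ (n + 1)) = {x | 0 ≤ x 0}`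
(Mathlib `range_modelWithCornersEuclideanHalfSpace`). [folklore] -/
theorem mem_range_modelHalfSpace_iff (y : 𝔼 (n + 1)) : y ∈ range (𝓡∂ (n + 1)) ↔ 0 ≤ y 0 := by
  rw [range_modelWithCornersEuclideanHalfSpace]
  rfl

/-- **Calculus at a boundary point of the half-space.** Let `τ : ℝⁿ⁺¹ → ℝⁿ⁺¹` have derivative
`L` within the half-space `K = {x 0 ≥ 0}` at a boundary point `x` (`x 0 = 0`), map `K` into `K`,
and map the boundary hyperplane near `x` into the boundary hyperplane, the induced boundary map
being `σ` (`τ (0, u) = (0, σ u)` for `u` near `tail x`). Then `σ` is differentiable at `tail x`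
with derivative `Lt = tail ∘ L ∘ (0, ·)`, `L` preserves the hyperplane acting there as `Lt`, and
`L` maps the inward normal `e₀` into `K`: `(L e₀) 0 ≥ 0` (one-sided directional derivative of
the non-negative function `t ↦ τ (x + t e₀) 0` vanishing at `t = 0`). This is the computation
behind "the differential of a boundary-preserving map at a boundary point is block triangular
with positive normal entry" (Hirsch, *Differential Topology* (1976), §4.4, p. 103, boundary
orientation; Lee, *Introduction to Smooth Manifolds* (2013), Prop. 15.24 ff.). [folklore] -/
theorem HalfSpace.hasFDerivAt_boundaryMap {τ : 𝔼 (n + 1) → 𝔼 (n + 1)} {σ : 𝔼 n → 𝔼 n}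
    {L : 𝔼 (n + 1) →L[ℝ] 𝔼 (n + 1)} {x : 𝔼 (n + 1)} (hx : x 0 = 0)
    (hτ : HasFDerivWithinAt τ L (range (𝓡∂ (n + 1))) x)
    (hστ : ∀ᶠ u in 𝓝 (tail n x), τ (consZeroL n u) = consZeroL n (σ u)) :
    HasFDerivAt σ ((tailL n).comp (L.comp (consZeroL n))) (tail n x) ∧
      L.comp (consZeroL n) = (consZeroL n).comp ((tailL n).comp (L.comp (consZeroL n))) := by
  have hx' : consZeroL n (tail n x) = x := consCLE_tail_of_eq_zero n hx
  -- the affine map `u ↦ (0, u)` lands in `K`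
  have hA : HasFDerivAt (fun u : 𝔼 n => consZeroL n u) (consZeroL n) (tail n x) :=
    (consZeroL n).hasFDerivAt
  have hcomp : HasFDerivAt (τ ∘ fun u => consZeroL n u) (L.comp (consZeroL n)) (tail n x) := by
    have hτ' : HasFDerivWithinAt τ L (range (𝓡∂ (n + 1))) (consZeroL n (tail n x)) := by
      rw [hx']; exact hτ
    refine hτ'.comp_hasFDerivAt (tail n x) hA (Filter.Eventually.of_forall fun u => ?_)
    rw [mem_range_modelHalfSpace_iff, consZeroL_apply_zero]
  -- hence `u ↦ (0, σ u)` has derivative `L ∘ (0, ·)`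
  have hcomp' : HasFDerivAt (fun u => consZeroL n (σ u)) (L.comp (consZeroL n)) (tail n x) :=
    hcomp.congr_of_eventuallyEq (hστ.mono fun u hu => hu.symm)
  have hσ : HasFDerivAt σ ((tailL n).comp (L.comp (consZeroL n))) (tail n x) := by
    have h := (tailL n).hasFDerivAt.comp (tail n x) hcomp'
    refine h.congr_of_eventuallyEq (Filter.Eventually.of_forall fun u => ?_)
    simp
  refine ⟨hσ, ?_⟩
  -- uniqueness of the derivative of `u ↦ (0, σ u)`
  have h2 : HasFDerivAt (fun u => consZeroL n (σ u)) ((consZeroL n).comp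
      ((tailL n).comp (L.comp (consZeroL n)))) (tail n x) :=
    (consZeroL n).hasFDerivAt.comp (tail n x) hσ
  exact hcomp'.unique h2

/-- Under the hypotheses of `HalfSpace.hasFDerivAt_boundaryMap`, if moreover `τ` takes values
in the half-space `K`, then `L e₀` points into `K`: `0 ≤ (L e₀) 0`. [folklore] -/
theorem HalfSpace.apply_e0_zero_nonneg {τ : 𝔼 (n + 1) → 𝔼 (n + 1)} {σ : 𝔼 n → 𝔼 n}
    {L : 𝔼 (n + 1) →L[ℝ] 𝔼 (n + 1)} {x : 𝔼 (n + 1)} (hx : x 0 = 0)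
    (hτ : HasFDerivWithinAt τ L (range (𝓡∂ (n + 1))) x)
    (hστ : ∀ᶠ u in 𝓝 (tail n x), τ (consZeroL n u) = consZeroL n (σ u))
    (hK : ∀ y, 0 ≤ τ y 0) : 0 ≤ L (e0 n) 0 := by
  have hx' : consZeroL n (tail n x) = x := consCLE_tail_of_eq_zero n hx
  have hτx : τ x 0 = 0 := by
    have h := hστ.self_of_nhds
    rw [hx'] at h
    rw [h]
    rfl
  -- the path `t ↦ x + t e₀` runs in `K` for `t ≥ 0`
  set γ : ℝ → 𝔼 (n + 1) := fun t => x + t • e0 n with hγ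
  have hγd : HasDerivWithinAt γ (e0 n) (Ici 0) 0 := by
    have h : HasDerivAt (fun t : ℝ => x + t • e0 n) ((1 : ℝ) • e0 n) 0 :=
      ((hasDerivAt_id (0 : ℝ)).smul_const (e0 n)).const_add x
    rw [one_smul] at h
    exact h.hasDerivWithinAt
  have hγ0 : γ 0 = x := by simp [hγ]
  have hmaps : MapsTo γ (Ici 0) (range (𝓡∂ (n + 1))) := by
    intro t ht
    rw [mem_range_modelHalfSpace_iff]
    show 0 ≤ (x + t • e0 n) 0
    simp only [PiLp.add_apply, PiLp.smul_apply, smul_eq_mul, hx, e0_apply_zero, mul_one, zero_add]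
    exact ht
  have hτγ : HasDerivWithinAt (τ ∘ γ) (L (e0 n)) (Ici 0) 0 := by
    have hτ' : HasFDerivWithinAt τ L (range (𝓡∂ (n + 1))) (γ 0) := by rw [hγ0]; exact hτ
    exact hτ'.comp_hasDerivWithinAt (0 : ℝ) hγd hmaps
  -- the `0`-th coordinate
  set g : ℝ → ℝ := fun t => τ (γ t) 0 with hg
  have hgd : HasDerivWithinAt g (L (e0 n) 0) (Ici 0) 0 := by
    have h := (EuclideanSpace.proj (0 : Fin (n + 1))).hasFDerivAt.comp_hasDerivWithinAt (0 : ℝ) hτγ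
    exact h
  have hg0 : g 0 = 0 := by simp [hg, hγ0, hτx]
  -- one-sided difference quotients are `≥ 0`
  rw [← hasDerivWithinAt_Ioi_iff_Ici,
    hasDerivWithinAt_iff_tendsto_slope' (show (0 : ℝ) ∉ Ioi 0 by simp)] at hgd
  refine ge_of_tendsto hgd (eventually_nhdsWithin_of_forall fun t ht => ?_)
  rw [slope_def_field, hg0, sub_zero, sub_zero]
  exact div_nonneg (hK _) (le_of_lt ht)

/-- **Sign of the Jacobian at a boundary point.** Under the hypotheses of
`HalfSpace.hasFDerivAt_boundaryMap` and `HalfSpace.apply_e0_zero_nonneg`, if the derivative `L`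
is invertible then its normal entry `(L e₀) 0` is positive and `det L = (L e₀) 0 · det Lt`, so
`det L` and the Jacobian `det Lt` of the boundary map have the same sign (Hirsch (1976), §4.4,
p. 103; Lee (2013), Prop. 15.24). [folklore] -/
theorem HalfSpace.det_pos_iff {τ : 𝔼 (n + 1) → 𝔼 (n + 1)} {σ : 𝔼 n → 𝔼 n}
    {L : 𝔼 (n + 1) →L[ℝ] 𝔼 (n + 1)} {x : 𝔼 (n + 1)} (hx : x 0 = 0)
    (hτ : HasFDerivWithinAt τ L (range (𝓡∂ (n + 1))) x)
    (hστ : ∀ᶠ u in 𝓝 (tail n x), τ (consZeroL n u) = consZeroL n (σ u))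
    (hK : ∀ y, 0 ≤ τ y 0) (hL : LinearMap.det (L : 𝔼 (n + 1) →ₗ[ℝ] 𝔼 (n + 1)) ≠ 0) :
    0 < L (e0 n) 0 ∧
      (0 < LinearMap.det (L : 𝔼 (n + 1) →ₗ[ℝ] 𝔼 (n + 1)) ↔
        0 < LinearMap.det (((tailL n).comp (L.comp (consZeroL n)) : 𝔼 n →L[ℝ] 𝔼 n) :
          𝔼 n →ₗ[ℝ] 𝔼 n)) := by
  obtain ⟨-, hblock⟩ := HalfSpace.hasFDerivAt_boundaryMap hx hτ hστ
  have hnn := HalfSpace.apply_e0_zero_nonneg hx hτ hστ hK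
  set Lt : 𝔼 n →L[ℝ] 𝔼 n := (tailL n).comp (L.comp (consZeroL n)) with hLt
  -- `L` is injective
  have hLinj : Function.Injective L := by
    have hu : IsUnit (L : 𝔼 (n + 1) →ₗ[ℝ] 𝔼 (n + 1)) :=
      (LinearMap.isUnit_iff_isUnit_det _).mpr (Ne.isUnit hL)
    exact (LinearMap.isUnit_iff_ker_eq_bot _).mp hu |> LinearMap.ker_eq_bot.mp
  -- the hyperplane `V₀ = {v | v 0 = 0}` is mapped onto itself
  let V₀ : Submodule ℝ (𝔼 (n + 1)) := LinearMap.ker (EuclideanSpace.proj (0 : Fin (n + 1)) :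
    𝔼 (n + 1) →L[ℝ] ℝ).toLinearMap
  have hmemV₀ : ∀ v : 𝔼 (n + 1), v ∈ V₀ ↔ v 0 = 0 := fun v => Iff.rfl
  have hLV : ∀ v ∈ V₀, L v ∈ V₀ := by
    intro v hv
    rw [hmemV₀] at hv ⊢
    have h1 : consZeroL n (tail n v) = v := consCLE_tail_of_eq_zero n hv
    have h2 := congrArg (fun f : 𝔼 n →L[ℝ] 𝔼 (n + 1) => f (tail n v)) hblock
    simp only [ContinuousLinearMap.comp_apply] at h2
    rw [h1] at h2
    rw [h2]
    rfl
  have hmap : Submodule.map (L : 𝔼 (n + 1) →ₗ[ℝ] 𝔼 (n + 1)) V₀ = V₀ := by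
    apply Submodule.eq_of_le_of_finrank_eq
    · rintro _ ⟨v, hv, rfl⟩
      exact hLV v hv
    · exact (Submodule.equivMapOfInjective _ hLinj V₀).finrank_eq.symm
  have hpos : 0 < L (e0 n) 0 := by
    refine lt_of_le_of_ne hnn fun h0 => ?_
    have hmem : L (e0 n) ∈ V₀ := (hmemV₀ _).mpr h0.symm
    rw [← hmap] at hmem
    obtain ⟨v, hv, hvL⟩ := hmem
    have hve : v = e0 n := hLinj hvL
    have hv' : e0 n ∈ V₀ := hve ▸ hv
    rw [hmemV₀, e0_apply_zero] at hv'
    exact one_ne_zero hv'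
  refine ⟨hpos, ?_⟩
  rw [det_eq_mul_det_of_comp_consZeroL L Lt hblock]
  exact ⟨fun h => pos_of_mul_pos_right h hpos.le, fun h => mul_pos hpos h⟩

end HalfSpace

/-! ### §3 Boundary-preserving maps read in the boundary charts -/

section Core

open BoundaryManifold

variable {n : ℕ} {W : Type u} [TopologicalSpace W] [ChartedSpace (EuclideanHalfSpace (n + 1)) W]
  [IsManifold (𝓡∂ (n + 1)) ∞ W]
  {W' : Type v} [TopologicalSpace W'] [ChartedSpace (EuclideanHalfSpace (n + 1)) W']
  [IsManifold (𝓡∂ (n + 1)) ∞ W']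

/-- The extended chart of `∂W` at `q` is the boundary chart `boundaryChart q` (the model of `∂W`
is the vector space `ℝⁿ` itself). [folklore] -/
@[simp]
theorem BoundaryManifold.extChartAt_coe (q : (𝓡∂ (n + 1)).boundary W) :
    ⇑(extChartAt (𝓡 n) q) = boundaryChart q := by
  rw [extChartAt, OpenPartialHomeomorph.extend_coe]
  rfl

/-- The inverse extended chart of `∂W` at `q` is `(boundaryChart q).symm`. [folklore] -/
@[simp]
theorem BoundaryManifold.extChartAt_symm_coe (q : (𝓡∂ (n + 1)).boundary W) :
    ⇑(extChartAt (𝓡 n) q).symm = (boundaryChart q).symm := by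
  rw [extChartAt, OpenPartialHomeomorph.extend_coe_symm]
  rfl

/-- **A boundary-preserving map read in boundary charts.** Let `Φ : W → W'` be a map of
manifolds with boundary restricting to `ρ : ∂W → ∂W'` (`(ρ z).1 = Φ z.1`), continuous at the
boundary point `z`, and suppose that `Φ`, written in the extended charts of `W` at `a.1 ∋ z.1`
and of `W'` at `c.1 ∋ Φ z.1` (`a`, `c` boundary points), has an invertible derivative `L` within
the model half-space at the image of `z.1`.  Then `ρ`, written in the boundary charts
`boundaryChart a`, `boundaryChart c` (`Cobordism.lean`: the charts of `W` restricted to the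
boundary, first coordinate dropped), is differentiable at the image of `z` with derivative
`Lt = tail ∘ L ∘ (0, ·)`, and `det L`, `det Lt` have the same sign
(`HalfSpace.hasFDerivAt_boundaryMap`, `HalfSpace.det_pos_iff`).  Hirsch, *Differential
Topology* (1976), §4.4, p. 103; Lee, *Introduction to Smooth Manifolds* (2013), Prop. 15.24.
[folklore] -/
theorem BoundaryManifold.hasFDerivAt_boundaryCharts {Φ : W → W'}
    {ρ : (𝓡∂ (n + 1)).boundary W → (𝓡∂ (n + 1)).boundary W'} (hρ : ∀ z, (ρ z).1 = Φ z.1)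
    (a z : (𝓡∂ (n + 1)).boundary W) (c : (𝓡∂ (n + 1)).boundary W')
    (hz : z.1 ∈ (chartAt (EuclideanHalfSpace (n + 1)) a.1).source)
    (hzc : Φ z.1 ∈ (chartAt (EuclideanHalfSpace (n + 1)) c.1).source) (hΦ : ContinuousAt Φ z.1)
    {L : 𝔼 (n + 1) →L[ℝ] 𝔼 (n + 1)}
    (hL : HasFDerivWithinAt (extChartAt (𝓡∂ (n + 1)) c.1 ∘ Φ ∘ (extChartAt (𝓡∂ (n + 1)) a.1).symm)
      L (range (𝓡∂ (n + 1))) (extChartAt (𝓡∂ (n + 1)) a.1 z.1))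
    (hLdet : LinearMap.det (L : 𝔼 (n + 1) →ₗ[ℝ] 𝔼 (n + 1)) ≠ 0) :
    HasFDerivAt (boundaryChart c ∘ ρ ∘ (boundaryChart a).symm)
        ((tailL n).comp (L.comp (consZeroL n))) (boundaryChart a z) ∧
      (0 < LinearMap.det (L : 𝔼 (n + 1) →ₗ[ℝ] 𝔼 (n + 1)) ↔
        0 < LinearMap.det (((tailL n).comp (L.comp (consZeroL n)) : 𝔼 n →L[ℝ] 𝔼 n) :
          𝔼 n →ₗ[ℝ] 𝔼 n)) := by
  set e := chartAt (EuclideanHalfSpace (n + 1)) a.1 with he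
  set e' := chartAt (EuclideanHalfSpace (n + 1)) c.1 with he'
  set x : 𝔼 (n + 1) := extChartAt (𝓡∂ (n + 1)) a.1 z.1 with hx_def
  have hxval : x = (e z.1).val := rfl
  have hx : x 0 = 0 := (mem_boundary_iff_of_mem_atlas (chart_mem_atlas _ a.1) hz).1 z.2
  have htail : tail n x = boundaryChart a z := rfl
  set τ : 𝔼 (n + 1) → 𝔼 (n + 1) :=
    extChartAt (𝓡∂ (n + 1)) c.1 ∘ Φ ∘ (extChartAt (𝓡∂ (n + 1)) a.1).symm with hτ_def
  have hτapp : ∀ y, τ y = (e' (Φ (e.symm ((𝓡∂ (n + 1)).symm y)))).val := fun y => rfl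
  set σ : 𝔼 n → 𝔼 n := boundaryChart c ∘ ρ ∘ (boundaryChart a).symm with hσ_def
  have hσapp : ∀ u, σ u = tail n (e' (ρ ((boundaryChart a).symm u)).1).val := fun u => rfl
  -- `τ` takes values in the half-space
  have hK : ∀ y, 0 ≤ τ y 0 := fun y => by
    rw [hτapp]
    exact (e' _).2
  -- near `tail x`, `τ (0, u) = (0, σ u)`
  have hu₀ : toHalfSpace n (tail n x) = e z.1 :=
    toHalfSpace_tail_chart (chart_mem_atlas _ a.1) hz z.2
  have h1 : ∀ᶠ u in 𝓝 (tail n x), toHalfSpace n u ∈ e.target := by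
    refine (continuous_toHalfSpace n).continuousAt.preimage_mem_nhds ?_
    rw [hu₀]
    exact e.open_target.mem_nhds (e.map_source hz)
  have h2 : ∀ᶠ u in 𝓝 (tail n x), Φ (e.symm (toHalfSpace n u)) ∈ e'.source := by
    have hc : ContinuousAt (fun u => Φ (e.symm (toHalfSpace n u))) (tail n x) := by
      refine ContinuousAt.comp (g := Φ) ?_ ?_
      · rw [hu₀, e.left_inv hz]
        exact hΦ
      · refine ContinuousAt.comp (g := e.symm) ?_ (continuous_toHalfSpace n).continuousAt
        rw [hu₀]
        exact e.continuousAt_symm (e.map_source hz)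
    refine hc.preimage_mem_nhds (e'.open_source.mem_nhds ?_)
    rw [hu₀, e.left_inv hz]
    exact hzc
  have hστ : ∀ᶠ u in 𝓝 (tail n x), τ (consZeroL n u) = consZeroL n (σ u) := by
    filter_upwards [h1, h2] with u hu hu'
    have hw : e.symm (toHalfSpace n u) ∈ (𝓡∂ (n + 1)).boundary W :=
      symm_toHalfSpace_mem_boundary (chart_mem_atlas _ a.1) hu
    set w : (𝓡∂ (n + 1)).boundary W := ⟨e.symm (toHalfSpace n u), hw⟩ with hw_def
    have hbc : (boundaryChart a).symm u = w := by
      apply Subtype.ext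
      rw [coe_boundaryChart_symm_of_mem a hu]
    have hτu : τ (consZeroL n u) = (e' (Φ w.1)).val := by
      rw [hτapp, consZeroL_apply, modelWithCorners_symm_consCLE]
    have hσu : σ u = tail n (e' (Φ w.1)).val := by
      rw [hσapp, hbc, hρ]
    have hb' : (e' (Φ w.1)).val 0 = 0 := by
      have hmem : Φ w.1 ∈ (𝓡∂ (n + 1)).boundary W' := hρ w ▸ (ρ w).2
      exact (mem_boundary_iff_of_mem_atlas (chart_mem_atlas _ c.1) hu').1 hmem
    rw [hτu, hσu, consZeroL_apply, consCLE_tail_of_eq_zero n hb']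
  exact ⟨(HalfSpace.hasFDerivAt_boundaryMap hx hL hστ).1,
    (HalfSpace.det_pos_iff hx hL hστ hK hLdet).2⟩

/-- **Chart changes of `∂W` versus chart changes of `W`.** At a point `q` of the domain of the
chart of `∂W` at `p`, the Jacobian determinant of the change of boundary charts `q → p`
(`tangentCoordChange (𝓡 n) q p q`) has the same sign as that of the change of charts of `W`
(`tangentCoordChange (𝓡∂ (n + 1)) q.1 p.1 q.1`): the latter is block triangular with positive
normal entry (Hirsch, *Differential Topology* (1976), §4.4, p. 103). [folklore] -/
theorem BoundaryManifold.det_tangentCoordChange_pos_iff (p q : (𝓡∂ (n + 1)).boundary W)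
    (hq : q.1 ∈ (chartAt (EuclideanHalfSpace (n + 1)) p.1).source) :
    (0 < LinearMap.det ((tangentCoordChange (𝓡 n) q p q : 𝔼 n →L[ℝ] 𝔼 n) : 𝔼 n →ₗ[ℝ] 𝔼 n) ↔
      0 < LinearMap.det ((tangentCoordChange (𝓡∂ (n + 1)) q.1 p.1 q.1 :
        𝔼 (n + 1) →L[ℝ] 𝔼 (n + 1)) : 𝔼 (n + 1) →ₗ[ℝ] 𝔼 (n + 1))) := by
  have hqq : q.1 ∈ (extChartAt (𝓡∂ (n + 1)) q.1).source := mem_extChartAt_source q.1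
  have hqp : q.1 ∈ (extChartAt (𝓡∂ (n + 1)) p.1).source := by rwa [extChartAt_source]
  have hL := hasFDerivWithinAt_tangentCoordChange (I := 𝓡∂ (n + 1)) ⟨hqq, hqp⟩
  have hdet : LinearMap.det ((tangentCoordChange (𝓡∂ (n + 1)) q.1 p.1 q.1 :
      𝔼 (n + 1) →L[ℝ] 𝔼 (n + 1)) : 𝔼 (n + 1) →ₗ[ℝ] 𝔼 (n + 1)) ≠ 0 :=
    left_ne_zero_of_mul_eq_one (det_tangentCoordChange_mul_det_tangentCoordChange hqq hqp)
  have hcore := BoundaryManifold.hasFDerivAt_boundaryCharts (W := W) (W' := W) (Φ := id) (ρ := id)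
    (fun _ => rfl) q q p (mem_chart_source _ q.1) hq continuousAt_id
    (L := tangentCoordChange (𝓡∂ (n + 1)) q.1 p.1 q.1) hL hdet
  rw [hcore.2]
  -- the boundary chart change has derivative `Lt`
  have hB : tangentCoordChange (𝓡 n) q p q = (tailL n).comp
      ((tangentCoordChange (𝓡∂ (n + 1)) q.1 p.1 q.1).comp (consZeroL n)) := by
    rw [tangentCoordChange_def, ModelWithCorners.Boundaryless.range_eq_univ, fderivWithin_univ,
      BoundaryManifold.extChartAt_coe, BoundaryManifold.extChartAt_symm_coe,
      BoundaryManifold.extChartAt_coe]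
    exact hcore.1.fderiv
  rw [hB]

/-- **The boundary restriction of a differentiable map, differentiated.** Let `Φ : W → W'`
restrict to `ρ : ∂W → ∂W'` (`(ρ z).1 = Φ z.1`) with `ρ` continuous at `z`, `Φ` differentiable at
`z.1` with invertible differential. Then `ρ` is differentiable at `z` with differential
`tail ∘ dΦ ∘ (0, ·)` (in the preferred charts), whose Jacobian determinant has the sign of that
of `dΦ` (Hirsch (1976), §4.4, p. 103; Lee (2013), Prop. 15.24). [folklore] -/
theorem BoundaryManifold.hasMFDerivAt_boundaryMap {Φ : W → W'}
    {ρ : (𝓡∂ (n + 1)).boundary W → (𝓡∂ (n + 1)).boundary W'} (hρ : ∀ z, (ρ z).1 = Φ z.1)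
    {z : (𝓡∂ (n + 1)).boundary W} (hΦ : MDifferentiableAt (𝓡∂ (n + 1)) (𝓡∂ (n + 1)) Φ z.1)
    (hρc : ContinuousAt ρ z)
    (hdet : LinearMap.det (M := 𝔼 (n + 1))
      (mfderiv (𝓡∂ (n + 1)) (𝓡∂ (n + 1)) Φ z.1).toLinearMap ≠ 0) :
    HasMFDerivAt (𝓡 n) (𝓡 n) ρ z
        ((tailL n).comp ((mfderiv (𝓡∂ (n + 1)) (𝓡∂ (n + 1)) Φ z.1 :
          𝔼 (n + 1) →L[ℝ] 𝔼 (n + 1)).comp (consZeroL n))) ∧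
      (0 < LinearMap.det (M := 𝔼 (n + 1))
          (mfderiv (𝓡∂ (n + 1)) (𝓡∂ (n + 1)) Φ z.1).toLinearMap ↔
        0 < LinearMap.det (M := 𝔼 n) ((tailL n).comp ((mfderiv (𝓡∂ (n + 1)) (𝓡∂ (n + 1)) Φ
          z.1 : 𝔼 (n + 1) →L[ℝ] 𝔼 (n + 1)).comp (consZeroL n))).toLinearMap) := by
  set L : 𝔼 (n + 1) →L[ℝ] 𝔼 (n + 1) := mfderiv (𝓡∂ (n + 1)) (𝓡∂ (n + 1)) Φ z.1 with hL_def
  have hL : HasFDerivWithinAt (writtenInExtChartAt (𝓡∂ (n + 1)) (𝓡∂ (n + 1)) z.1 Φ) L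
      (range (𝓡∂ (n + 1))) (extChartAt (𝓡∂ (n + 1)) z.1 z.1) := hΦ.hasMFDerivAt.2
  have hzc : Φ z.1 ∈ (chartAt (EuclideanHalfSpace (n + 1)) (ρ z).1).source := by
    rw [hρ z]
    exact mem_chart_source _ (Φ z.1)
  have hL' : HasFDerivWithinAt
      (extChartAt (𝓡∂ (n + 1)) (ρ z).1 ∘ Φ ∘ (extChartAt (𝓡∂ (n + 1)) z.1).symm)
      L (range (𝓡∂ (n + 1))) (extChartAt (𝓡∂ (n + 1)) z.1 z.1) := by
    rw [hρ z]
    exact hL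
  have hcore := BoundaryManifold.hasFDerivAt_boundaryCharts hρ z z (ρ z) (mem_chart_source _ z.1)
    hzc hΦ.continuousAt hL' hdet
  refine ⟨⟨hρc, ?_⟩, hcore.2⟩
  rw [writtenInExtChartAt, ModelWithCorners.Boundaryless.range_eq_univ,
    BoundaryManifold.extChartAt_coe, BoundaryManifold.extChartAt_symm_coe,
    BoundaryManifold.extChartAt_coe, hasFDerivWithinAt_univ]
  exact hcore.1

end Core

/-! ### §4 The boundary orientation of an oriented manifold with boundary -/

section Orientation

open BoundaryManifold

variable {n : ℕ}

open Classical in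
/-- Transfer of orientations from `ℝⁿ⁺¹` (coordinates of a boundary chart, half-space
`{0 ≤ x 0}`, so `e₀` is the *inward* normal) to `ℝⁿ` (coordinates of the restricted boundary
chart), with the **outward normal first** convention of Hirsch (1976), §4.4 and Lee (2013),
Prop. 15.24: `(v₁, …, vₙ)` is positive for the boundary orientation iff `(-e₀, v₁, …, vₙ)` is
positive.  Since `det[-e₀, (0, v₁), …, (0, vₙ)] = -det[v₁, …, vₙ]`, the standard orientation of
`ℝⁿ⁺¹` (`Literature.Topology.FourManifolds.euclideanOrientation`) goes to the *opposite* of the standard orientation of `ℝⁿ`,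
and its opposite to the standard one. [cite: HirschDT1976, §4.4 p. 103] -/
def boundaryOrientationMap (n : ℕ) (x : Orientation ℝ (𝔼 (n + 1)) (Fin (finrank ℝ (𝔼 (n + 1))))) :
    Orientation ℝ (𝔼 n) (Fin (finrank ℝ (𝔼 n))) :=
  if x = euclideanOrientation (n + 1) then -euclideanOrientation n else euclideanOrientation n

/-- The transfer of orientations commutes with negation. [folklore] -/
theorem boundaryOrientationMap_neg (x : Orientation ℝ (𝔼 (n + 1)) (Fin (finrank ℝ (𝔼 (n + 1))))) :
    boundaryOrientationMap n (-x) = -boundaryOrientationMap n x := by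
  have hne : euclideanOrientation (n + 1) ≠ -euclideanOrientation (n + 1) := Module.Ray.ne_neg_self _
  unfold boundaryOrientationMap
  rcases orientation_eq_or_eq_neg x (euclideanOrientation (n + 1)) with rfl | rfl
  · have h3 : - -euclideanOrientation n = euclideanOrientation n :=
      _root_.neg_neg (euclideanOrientation n)
    rw [if_neg hne.symm, if_pos rfl, h3]
  · have h2 : - -euclideanOrientation (n + 1) = euclideanOrientation (n + 1) :=
      _root_.neg_neg (euclideanOrientation (n + 1))
    rw [h2, if_pos rfl, if_neg hne.symm]

/-- The transfer of orientations is injective. [folklore] -/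
theorem boundaryOrientationMap_eq_iff
    (x y : Orientation ℝ (𝔼 (n + 1)) (Fin (finrank ℝ (𝔼 (n + 1))))) :
    boundaryOrientationMap n x = boundaryOrientationMap n y ↔ x = y := by
  have hne : euclideanOrientation (n + 1) ≠ -euclideanOrientation (n + 1) := Module.Ray.ne_neg_self _
  have hne' : euclideanOrientation n ≠ -euclideanOrientation n := Module.Ray.ne_neg_self _
  refine ⟨fun h => ?_, fun h => h ▸ rfl⟩
  unfold boundaryOrientationMap at h
  rcases orientation_eq_or_eq_neg x (euclideanOrientation (n + 1)) with rfl | rfl <;>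
    rcases orientation_eq_or_eq_neg y (euclideanOrientation (n + 1)) with rfl | rfl
  · rfl
  · rw [if_pos rfl, if_neg hne.symm] at h
    exact absurd h.symm hne'
  · rw [if_pos rfl, if_neg hne.symm] at h
    exact absurd h hne'
  · rfl

variable {W : Type u} [TopologicalSpace W] [ChartedSpace (EuclideanHalfSpace (n + 1)) W]
  [IsManifold (𝓡∂ (n + 1)) ∞ W]
  {W' : Type v} [TopologicalSpace W'] [ChartedSpace (EuclideanHalfSpace (n + 1)) W']
  [IsManifold (𝓡∂ (n + 1)) ∞ W']

/-- **The boundary orientation (outward normal first).** A smooth orientation `o` of a manifold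
with boundary `W` (model `𝓡∂ (n + 1)`) induces a smooth orientation of its boundary manifold
`∂W = (𝓡∂ (n + 1)).boundary W` (restricted boundary charts, `Cobordism.lean`): at `p ∈ ∂W` it is
the transfer `boundaryOrientationMap` of `o p` — the Hirsch/Lee convention "`(v₁, …, vₙ)` is
positive iff `(ν, v₁, …, vₙ)` is positive, `ν` the outward normal" read in the boundary chart at
`p` (where `ν = -e₀`), i.e. the tree's convention under which the standard orientation of `𝕊ⁿ`
is the boundary orientation of `𝔻ⁿ⁺¹` (`SmoothOrientationSphereProofs.lean`).  Local constancy: the charts of `∂W` at `q` and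
`p` are the charts of `W` at `q.1`, `p.1` restricted to the boundary, and the Jacobian of the chart
change of `W` at a boundary point is block triangular with positive normal entry, so it has the
sign of the Jacobian of the boundary chart change (`BoundaryManifold.det_tangentCoordChange_pos_iff`).
Hirsch, *Differential Topology* (1976), §4.4, p. 103 ("`∂M` is orientable if `M` is"); Lee,
*Introduction to Smooth Manifolds* (2013), Prop. 15.24. [cite: HirschDT1976, §4.4 p. 103] -/
def SmoothOrientation.boundary (o : SmoothOrientation (𝓡∂ (n + 1)) W) :
    SmoothOrientation (𝓡 n) ((𝓡∂ (n + 1)).boundary W) where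
  toFun p := boundaryOrientationMap n (o p.1)
  eventually_eq_iff' p := by
    have h1 : ∀ᶠ q : (𝓡∂ (n + 1)).boundary W in 𝓝 p, (o q.1 = o p.1 ↔
        0 < LinearMap.det ((tangentCoordChange (𝓡∂ (n + 1)) q.1 p.1 q.1 :
          𝔼 (n + 1) →L[ℝ] 𝔼 (n + 1)) : 𝔼 (n + 1) →ₗ[ℝ] 𝔼 (n + 1))) :=
      continuous_subtype_val.continuousAt.eventually (o.eventually_eq_iff p.1)
    have h2 : ∀ᶠ q : (𝓡∂ (n + 1)).boundary W in 𝓝 p,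
        q.1 ∈ (chartAt (EuclideanHalfSpace (n + 1)) p.1).source :=
      continuous_subtype_val.continuousAt.preimage_mem_nhds
        ((chartAt _ p.1).open_source.mem_nhds (mem_chart_source _ p.1))
    filter_upwards [h1, h2] with q hq hq'
    rw [boundaryOrientationMap_eq_iff, hq, BoundaryManifold.det_tangentCoordChange_pos_iff p q hq']

/-- The value of the boundary orientation (definitional). [folklore] -/
@[simp]
theorem SmoothOrientation.boundary_apply (o : SmoothOrientation (𝓡∂ (n + 1)) W)
    (p : (𝓡∂ (n + 1)).boundary W) : o.boundary p = boundaryOrientationMap n (o p.1) := rfl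

/-- The boundary orientation of the opposite orientation is the opposite boundary orientation.
[folklore] -/
@[simp]
theorem SmoothOrientation.boundary_neg (o : SmoothOrientation (𝓡∂ (n + 1)) W) :
    (-o).boundary = -o.boundary := by
  ext1 p
  simp [boundaryOrientationMap_neg]

variable (n W) in
/-- **The boundary of an orientable manifold with boundary is orientable** (Hirsch,
*Differential Topology* (1976), §4.4, p. 103; Lee, *Introduction to Smooth Manifolds* (2013),
Prop. 15.24). [cite: HirschDT1976, §4.4 p. 103] -/
theorem isOrientable_boundary (h : IsOrientable (𝓡∂ (n + 1)) W) :
    IsOrientable (𝓡 n) ((𝓡∂ (n + 1)).boundary W) := by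
  obtain ⟨o⟩ := h
  exact ⟨o.boundary⟩

/-- **Boundary restrictions of orientation-preserving maps preserve the boundary orientations.**
Let `Φ : W → W'` be differentiable with everywhere invertible differential, restricting to a
continuous map `ρ : ∂W → ∂W'` (`(ρ z).1 = Φ z.1`). If `Φ` preserves the orientations `o`, `o'`,
then `ρ` preserves the boundary orientations `o.boundary`, `o'.boundary`: pointwise, the Jacobian
of `ρ` has the sign of the Jacobian of `Φ` (`BoundaryManifold.hasMFDerivAt_boundaryMap`).
Hirsch, *Differential Topology* (1976), §4.4, p. 103. [cite: HirschDT1976, §4.4 p. 103] -/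
theorem IsOrientationPreserving.boundaryMap {Φ : W → W'}
    {ρ : (𝓡∂ (n + 1)).boundary W → (𝓡∂ (n + 1)).boundary W'} (hρ : ∀ z, (ρ z).1 = Φ z.1)
    (hΦ : MDifferentiable (𝓡∂ (n + 1)) (𝓡∂ (n + 1)) Φ) (hρc : Continuous ρ)
    (hdet : ∀ x, LinearMap.det (M := 𝔼 (n + 1))
      (mfderiv (𝓡∂ (n + 1)) (𝓡∂ (n + 1)) Φ x).toLinearMap ≠ 0)
    {o : SmoothOrientation (𝓡∂ (n + 1)) W} {o' : SmoothOrientation (𝓡∂ (n + 1)) W'}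
    (h : IsOrientationPreserving o o' Φ) :
    IsOrientationPreserving o.boundary o'.boundary ρ := by
  intro z
  obtain ⟨hd, hiff⟩ :=
    BoundaryManifold.hasMFDerivAt_boundaryMap hρ (hΦ z.1) hρc.continuousAt (hdet z.1)
  rw [hd.mfderiv, SmoothOrientation.boundary_apply, SmoothOrientation.boundary_apply, hρ z,
    boundaryOrientationMap_eq_iff, h z.1]
  exact hiff

/-- **Boundary restrictions of orientation-reversing maps reverse the boundary orientations**
(same hypotheses as `IsOrientationPreserving.boundaryMap`). Hirsch, *Differential Topology*
(1976), §4.4, p. 103. [cite: HirschDT1976, §4.4 p. 103] -/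
theorem IsOrientationReversing.boundaryMap {Φ : W → W'}
    {ρ : (𝓡∂ (n + 1)).boundary W → (𝓡∂ (n + 1)).boundary W'} (hρ : ∀ z, (ρ z).1 = Φ z.1)
    (hΦ : MDifferentiable (𝓡∂ (n + 1)) (𝓡∂ (n + 1)) Φ) (hρc : Continuous ρ)
    (hdet : ∀ x, LinearMap.det (M := 𝔼 (n + 1))
      (mfderiv (𝓡∂ (n + 1)) (𝓡∂ (n + 1)) Φ x).toLinearMap ≠ 0)
    {o : SmoothOrientation (𝓡∂ (n + 1)) W} {o' : SmoothOrientation (𝓡∂ (n + 1)) W'}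
    (h : IsOrientationReversing o o' Φ) :
    IsOrientationReversing o.boundary o'.boundary ρ := by
  have h' : IsOrientationPreserving o (-o') Φ := h
  have h'' := IsOrientationPreserving.boundaryMap hρ hΦ hρc hdet h'
  rw [SmoothOrientation.boundary_neg] at h''
  exact h''

/-- **Diffeomorphisms: the boundary restriction of an orientation-preserving diffeomorphism is
orientation preserving** for the boundary orientations (`ρ` any map with `(ρ z).1 = Φ z.1`; it
is then automatically continuous). Hirsch (1976), §4.4, p. 103. [cite: HirschDT1976, §4.4 p. 103] -/
theorem _root_.Diffeomorph.isOrientationPreserving_boundaryMap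
    (Φ : W ≃ₘ⟮𝓡∂ (n + 1), 𝓡∂ (n + 1)⟯ W')
    {ρ : (𝓡∂ (n + 1)).boundary W → (𝓡∂ (n + 1)).boundary W'} (hρ : ∀ z, (ρ z).1 = Φ z.1)
    {o : SmoothOrientation (𝓡∂ (n + 1)) W} {o' : SmoothOrientation (𝓡∂ (n + 1)) W'}
    (h : Φ.IsOrientationPreserving o o') : IsOrientationPreserving o.boundary o'.boundary ρ := by
  have hρc : Continuous ρ := by
    rw [Topology.IsInducing.subtypeVal.continuous_iff]
    have : Subtype.val ∘ ρ = Φ ∘ Subtype.val := funext hρ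
    rw [this]
    exact Φ.continuous.comp continuous_subtype_val
  exact IsOrientationPreserving.boundaryMap hρ (Φ.mdifferentiable (by simp)) hρc
    (Φ.det_mfderiv_ne_zero (by simp)) h

/-- **Diffeomorphisms: the boundary restriction of an orientation-reversing diffeomorphism is
orientation reversing** for the boundary orientations. Hirsch (1976), §4.4, p. 103.
[cite: HirschDT1976, §4.4 p. 103] -/
theorem _root_.Diffeomorph.isOrientationReversing_boundaryMap
    (Φ : W ≃ₘ⟮𝓡∂ (n + 1), 𝓡∂ (n + 1)⟯ W')
    {ρ : (𝓡∂ (n + 1)).boundary W → (𝓡∂ (n + 1)).boundary W'} (hρ : ∀ z, (ρ z).1 = Φ z.1)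
    {o : SmoothOrientation (𝓡∂ (n + 1)) W} {o' : SmoothOrientation (𝓡∂ (n + 1)) W'}
    (h : Φ.IsOrientationReversing o o') : IsOrientationReversing o.boundary o'.boundary ρ := by
  have hρc : Continuous ρ := by
    rw [Topology.IsInducing.subtypeVal.continuous_iff]
    have : Subtype.val ∘ ρ = Φ ∘ Subtype.val := funext hρ
    rw [this]
    exact Φ.continuous.comp continuous_subtype_val
  exact IsOrientationReversing.boundaryMap hρ (Φ.mdifferentiable (by simp)) hρc
    (Φ.det_mfderiv_ne_zero (by simp)) h

end Orientation

/-! ### §5 Orientations of arbitrary boundary data -/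

section BoundaryDataOrientation

variable {n : ℕ} {W : Type u} [TopologicalSpace W] [ChartedSpace (EuclideanHalfSpace (n + 1)) W]
  [IsManifold (𝓡∂ (n + 1)) ∞ W]

/-- The orientation of the carrier of an arbitrary boundary datum `b` of `W` (model `𝓡 n`)
induced by an orientation `o` of `W` (outward normal first, as `SmoothOrientation.boundary`): the
boundary orientation `o.boundary` of the canonical boundary manifold `∂W` pulled back along the
canonical diffeomorphism `b.carrier ≅ ∂W`
(`BoundaryData.restrictDiffeomorph` of the identity, `CorkDecomposition.lean`;
`SmoothOrientation.comap`). Hirsch,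
*Differential Topology* (1976), §4.4, p. 103. [cite: HirschDT1976, §4.4 p. 103] -/
def BoundaryData.orientation (b : BoundaryData (𝓡∂ (n + 1)) W (𝓡 n))
    (o : SmoothOrientation (𝓡∂ (n + 1)) W) : SmoothOrientation (𝓡 n) b.carrier :=
  o.boundary.comap (b.restrictDiffeomorph (BoundaryManifold.boundaryData n W)
    (Diffeomorph.refl (𝓡∂ (n + 1)) W ∞)) (by simp)

/-- **The boundary surface of an orientable manifold with boundary is orientable**, for any
boundary datum (Hirsch, *Differential Topology* (1976), §4.4, p. 103).
[cite: HirschDT1976, §4.4 p. 103] -/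
theorem BoundaryData.isOrientable_carrier (b : BoundaryData (𝓡∂ (n + 1)) W (𝓡 n))
    (h : IsOrientable (𝓡∂ (n + 1)) W) : IsOrientable (𝓡 n) b.carrier := by
  obtain ⟨o⟩ := h
  exact ⟨b.orientation o⟩

end BoundaryDataOrientation

end Literature.Topology.FourManifolds
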